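import Summits.Ventures.HSemireg.EdgeDigitSupport
import Summits.Ventures.HSemireg.LeadingDigitRemainder

/-!
# The edge unit's leading digit from CRITERION L at `k = 2` (pub-hsemireg, S4-PUSH corner 2)

Kernel leg of seat s4-search-2 gen 17 (cell `pub-hsemireg`), ROW T.  ROW J (`EdgeUnitClassDead.edge_unit_classDead`)
proves the (2,2,3,3,3,3) edge unit CLASS-DEAD for a class 2-form `B = C + 2X` whose LEADING DIGIT `C` is an integral
2-form on the slot pair `x₀, …, x₃` (`C = β₀₁h₀ + β₂₃h₁ + n₁l₁ + ⋯ + n₄l₄`) with ODD Pfaffian and whose first digit `X`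
is any integral 2-form — the framework word «leading-digit identification: non-degenerate digit on the slot pair».
This file derives that shape from CRITERION L at `k = 2` alone (`edge_leadingDigit_of_criterionL_two`): for ANY
`B` in the `ℤ`-span of the 2-vectors with `B·B = 2B₂`, the registered `T₂ = σ₂D₂ − 4σ₁DB + 16σ₀B₂` of the edge type
(`σ₁ = 0`, `σ₂ = 4t − σ₀`, `σ₀ = 2s + 1`, `D₂ = 16H₂ + 32HS₁ + 64S₂`) is `16(B₂ − H₂) + 32W₁`; so `T₂ = 64Z₂` forces
`B₂ = H₂ + 2W₀` (cancel `16`), `B·B = 2·x₀x₁x₂x₃ + 4W₀`; by ROW S the Pfaffian `Pf₀₁₂₃` of `B`'s coefficient array is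
odd and every Pfaffian missing one of `0, 1, 2, 3` is even, hence (ROW S over `𝔽₂`) every coefficient off the slot
pair is even, and `split_slotPair` writes `B = C + 2X` with `C` on the slot pair (odd Pfaffian) and `X` in the span
of the 2-vectors.  `sum_pairs_twelve` writes a strictly-upper double sum over `Fin 12` as the sixty-six explicit
terms of ROW J's hypothesis `hX` (used by ROW U).

Scope ∕ honest framing as in ROW J: a CLASS-LEVEL statement for ONE unit type of a NECESSARY-condition sieve
(CRITERION L) at the special fibre `E⁶`; CRITERION L as the registered necessary condition, the signature table and
the census remain framework words; theorems only (count-neutral, no `def`); no object, no `σ` computation, no Hodge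
statement; nothing here bears on HC ∕ HC_CM ∕ HC_AV.
-/

namespace Summit.Ventures.HSemireg.EdgeLeadingDigit

open ExteriorAlgebra DecomposableTwoForms DividedSquareParity EdgeDigitSupport

section Pairs

/-- The strictly-upper double sum over `Fin 12` written out: the sixty-six pairs `a < b` in lexicographic order
(the shape of the first-digit hypothesis `hX` of `EdgeUnitClassDead.edge_unit_classDead`). -/
theorem sum_pairs_twelve {A : Type*} [AddCommMonoid A] (t : Fin 12 → Fin 12 → A) :
    (∑ a, ∑ b, if a < b then t a b else 0) =
      t 0 1 + t 0 2 + t 0 3 + t 0 4 + t 0 5 + t 0 6 + t 0 7 + t 0 8 + t 0 9 + t 0 10 + t 0 11 + t 1 2 + t 1 3 + t 1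
      4 + t 1 5 + t 1 6 + t 1 7 + t 1 8 + t 1 9 + t 1 10 + t 1 11 + t 2 3 + t 2 4 + t 2 5 + t 2 6 + t 2 7 + t 2 8 +
      t 2 9 + t 2 10 + t 2 11 + t 3 4 + t 3 5 + t 3 6 + t 3 7 + t 3 8 + t 3 9 + t 3 10 + t 3 11 + t 4 5 + t 4 6 + t
      4 7 + t 4 8 + t 4 9 + t 4 10 + t 4 11 + t 5 6 + t 5 7 + t 5 8 + t 5 9 + t 5 10 + t 5 11 + t 6 7 + t 6 8 + t 6
      9 + t 6 10 + t 6 11 + t 7 8 + t 7 9 + t 7 10 + t 7 11 + t 8 9 + t 8 10 + t 8 11 + t 9 10 + t 9 11 + t 10 11 := by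
  simp only [Fin.sum_univ_succ, Fin.sum_univ_zero, Fin.isValue, Fin.succ_zero_eq_one, Fin.succ_one_eq_two]
  simp [Fin.lt_def]
  abel

end Pairs

section Edge

variable {M : Type*} [AddCommGroup M] [Module ℤ M]

/-- **Splitting off the slot pair.**  If the coefficients `c a b` with `a` or `b` outside `{0, 1, 2, 3}` are even,
then `Σ_{a<b} c a b · ι x_a ι x_b = (c₀₁h₀ + c₂₃h₁ + (c₀₂l₁ + c₀₃l₂ + c₁₂l₃ + c₁₃l₄)) + 2·X` with `X` in the span
of the 2-vectors (`h₀ = x₀x₁`, `h₁ = x₂x₃`, `l₁ = x₀x₂`, `l₂ = x₀x₃`, `l₃ = x₁x₂`, `l₄ = x₁x₃`, as in ROW J). -/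
theorem split_slotPair (x : Fin 12 → M) (c : Fin 12 → Fin 12 → ℤ)
    (hea : ∀ a b : Fin 12, a ≠ 0 → a ≠ 1 → a ≠ 2 → a ≠ 3 → (2 : ℤ) ∣ c a b)
    (heb : ∀ a b : Fin 12, b ≠ 0 → b ≠ 1 → b ≠ 2 → b ≠ 3 → (2 : ℤ) ∣ c a b) :
    ∃ X ∈ Submodule.span ℤ (Set.range fun p : M × M => ι ℤ p.1 * ι ℤ p.2),
      (∑ a, ∑ b, if a < b then (c a b : ExteriorAlgebra ℤ M) * (ι ℤ (x a) * ι ℤ (x b)) else 0)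
        = ((c 0 1 : ExteriorAlgebra ℤ M) * (ι ℤ (x 0) * ι ℤ (x 1))
            + (c 2 3 : ExteriorAlgebra ℤ M) * (ι ℤ (x 2) * ι ℤ (x 3))
            + ((c 0 2 : ExteriorAlgebra ℤ M) * (ι ℤ (x 0) * ι ℤ (x 2))
              + (c 0 3 : ExteriorAlgebra ℤ M) * (ι ℤ (x 0) * ι ℤ (x 3))
              + (c 1 2 : ExteriorAlgebra ℤ M) * (ι ℤ (x 1) * ι ℤ (x 2))
              + (c 1 3 : ExteriorAlgebra ℤ M) * (ι ℤ (x 1) * ι ℤ (x 3)))) + 2 * X := by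
  set Λ' := ExteriorAlgebra ℤ M
  set f : Fin 4 → Fin 12 := ![0, 1, 2, 3] with hf
  have hinj : Function.Injective f :=
    injective_vecFour (by decide) (by decide) (by decide) (by decide) (by decide) (by decide)
  set S : Finset (Fin 12) := Finset.univ.image f with hS
  have hfS : ∀ r, f r ∈ S := fun r => Finset.mem_image_of_mem f (Finset.mem_univ r)
  have m0 : (0 : Fin 12) ∈ S := by simpa [hf] using hfS 0
  have m1 : (1 : Fin 12) ∈ S := by simpa [hf] using hfS 1
  have m2 : (2 : Fin 12) ∈ S := by simpa [hf] using hfS 2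
  have m3 : (3 : Fin 12) ∈ S := by simpa [hf] using hfS 3
  have hnS : ∀ a, a ∉ S → a ≠ 0 ∧ a ≠ 1 ∧ a ≠ 2 ∧ a ≠ 3 := by
    intro a ha
    refine ⟨?_, ?_, ?_, ?_⟩ <;> rintro rfl
    · exact ha m0
    · exact ha m1
    · exact ha m2
    · exact ha m3
  -- split the coefficients: `c = cS + 2d`, `cS` supported on `S × S`
  set cS : Fin 12 → Fin 12 → ℤ := fun a b => if a ∈ S ∧ b ∈ S then c a b else 0 with hcS
  set d : Fin 12 → Fin 12 → ℤ := fun a b => if a ∈ S ∧ b ∈ S then 0 else c a b / 2 with hd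
  have hsplit : ∀ a b, c a b = cS a b + 2 * d a b := by
    intro a b
    simp only [hcS, hd]
    by_cases h : a ∈ S ∧ b ∈ S
    · simp [h]
    · simp only [h, if_false, zero_add]
      have h2 : (2 : ℤ) ∣ c a b := by
        rcases not_and_or.mp h with ha | hb
        · obtain ⟨h0, h1, h2, h3⟩ := hnS a ha; exact hea a b h0 h1 h2 h3
        · obtain ⟨h0, h1, h2, h3⟩ := hnS b hb; exact heb a b h0 h1 h2 h3
      exact (Int.mul_ediv_cancel' h2).symm
  refine ⟨∑ a, ∑ b, if a < b then (d a b : Λ') * (ι ℤ (x a) * ι ℤ (x b)) else 0, ?_, ?_⟩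
  · refine Submodule.sum_mem _ fun a _ => Submodule.sum_mem _ fun b _ => ?_
    split_ifs
    · rw [← zsmul_eq_mul]
      exact Submodule.smul_mem _ _ (Submodule.subset_span ⟨(x a, x b), rfl⟩)
    · exact Submodule.zero_mem _
  -- `Σ c = Σ cS + 2·Σ d`
  have hsum : (∑ a, ∑ b, if a < b then (c a b : Λ') * (ι ℤ (x a) * ι ℤ (x b)) else 0)
      = (∑ a, ∑ b, if a < b then (cS a b : Λ') * (ι ℤ (x a) * ι ℤ (x b)) else 0)
        + 2 * ∑ a, ∑ b, if a < b then (d a b : Λ') * (ι ℤ (x a) * ι ℤ (x b)) else 0 := by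
    rw [Finset.mul_sum, ← Finset.sum_add_distrib]
    refine Finset.sum_congr rfl fun a _ => ?_
    rw [Finset.mul_sum, ← Finset.sum_add_distrib]
    refine Finset.sum_congr rfl fun b _ => ?_
    split_ifs
    · rw [hsplit a b, Int.cast_add, Int.cast_mul, Int.cast_ofNat, add_mul, mul_assoc]
    · simp
  -- the `cS` sum is the six slot-pair terms
  obtain ⟨g, hg⟩ : ∃ g : Fin 12 → Fin 12 → Λ',
      g = fun a b => if a < b then (cS a b : Λ') * (ι ℤ (x a) * ι ℤ (x b)) else 0 := ⟨_, rfl⟩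
  have hga : ∀ a, a ∉ S → ∀ b, g a b = 0 := by
    intro a ha b
    simp only [hg, hcS, if_neg (fun h : a ∈ S ∧ b ∈ S => ha h.1), Int.cast_zero, zero_mul, ite_self]
  have hgb : ∀ b, b ∉ S → ∀ a, g a b = 0 := by
    intro b hb a
    simp only [hg, hcS, if_neg (fun h : a ∈ S ∧ b ∈ S => hb h.2), Int.cast_zero, zero_mul, ite_self]
  have h1 : ∑ a, ∑ b, g a b = ∑ a ∈ S, ∑ b ∈ S, g a b := by
    rw [← Finset.sum_subset (Finset.subset_univ S) (fun a _ ha => Finset.sum_eq_zero fun b _ => hga a ha b)]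
    refine Finset.sum_congr rfl fun a _ => ?_
    exact (Finset.sum_subset (Finset.subset_univ S) fun b _ hb => hgb b hb a).symm
  have h2 : ∑ a ∈ S, ∑ b ∈ S, g a b = ∑ r, ∑ s, g (f r) (f s) := by
    rw [hS, Finset.sum_image fun r _ s _ h => hinj h]
    refine Finset.sum_congr rfl fun r _ => ?_
    rw [Finset.sum_image fun r _ s _ h => hinj h]
  have h3 : ∀ r s, g (f r) (f s)
      = if f r < f s then (c (f r) (f s) : Λ') * (ι ℤ (x (f r)) * ι ℤ (x (f s))) else 0 := by
    intro r s; simp only [hg, hcS, if_pos (And.intro (hfS r) (hfS s))]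
  have hsix : (∑ a, ∑ b, if a < b then (cS a b : Λ') * (ι ℤ (x a) * ι ℤ (x b)) else 0)
      = (c 0 1 : Λ') * (ι ℤ (x 0) * ι ℤ (x 1)) + (c 2 3 : Λ') * (ι ℤ (x 2) * ι ℤ (x 3))
        + ((c 0 2 : Λ') * (ι ℤ (x 0) * ι ℤ (x 2)) + (c 0 3 : Λ') * (ι ℤ (x 0) * ι ℤ (x 3))
          + (c 1 2 : Λ') * (ι ℤ (x 1) * ι ℤ (x 2)) + (c 1 3 : Λ') * (ι ℤ (x 1) * ι ℤ (x 3))) := by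
    rw [show (∑ a, ∑ b, if a < b then (cS a b : Λ') * (ι ℤ (x a) * ι ℤ (x b)) else 0) = ∑ a, ∑ b, g a b by
      rw [hg], h1, h2]
    simp only [Fin.sum_univ_four, h3]
    simp [hf, Fin.lt_def]
    abel
  rw [hsum, hsix]

/-- **THE EDGE UNIT'S LEADING DIGIT, FROM CRITERION L AT `k = 2`.**  Setting of ROW J
(`EdgeUnitClassDead.edge_unit_classDead`: slots `h₀ = x₀x₁`, `h₁ = x₂x₃`, cross lines `l₁, …, l₄`, `H = h₀ + h₁`,
`H₂ = h₀h₁`, `S₁, S₂`, the edge type `D = 4H + 8S₁` with `D₂ = 16H₂ + 32HS₁ + 64S₂`, signature `σ₁ = 0`,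
`σ₂ = 4t − σ₀`, `σ₀ = 2s + 1`, the registered `T₂(B) = σ₂D₂ − 4σ₁DB + 16σ₀B₂`), with the class 2-form `B` ANY
element of the `ℤ`-span of the 2-vectors and `B·B = 2B₂`.  IF CRITERION L holds at `k = 2` (`T₂ = 64·Z₂`) THEN
`B = C + 2X` with `C = β₀₁h₀ + β₂₃h₁ + (n₁l₁ + n₂l₂ + n₃l₃ + n₄l₄)` INTEGRAL ON THE SLOT PAIR with ODD Pfaffian
`β₀₁β₂₃ + (n₂n₃ − n₁n₄) = 2p + 1` and `X` in the span of the 2-vectors — exactly the leading-digit hypotheses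
`hC`, `hp` of ROW J.  Mechanism: `T₂ = 16(B₂ − H₂) + 32W₁`, so `B₂ = H₂ + 2W₀` and `B·B = 2·x₀x₁x₂x₃ + 4W₀`; the
coefficient functionals then give `Pf₀₁₂₃(c)` odd and every Pfaffian missing one of `0, 1, 2, 3` even
(`pfaffian_odd_of_sq`, `pfaffian_even_of_sq_outside`); over `𝔽₂` this pins the support of `c̄` to `{0, 1, 2, 3}`
(`support_of_pfaffians`), and `split_slotPair` rewrites `B`. -/
theorem edge_leadingDigit_of_criterionL_two (x : Module.Basis (Fin 12) ℤ M)
    (h₀ h₁ l₁ l₂ l₃ l₄ h₂ h₃ h₄ h₅ σ₀ σ₁ σ₂ s t H H₂ S₁ S₂ D D₂ B B₂ T₂ Z₂ : ExteriorAlgebra ℤ M)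
    (hh₀ : h₀ = ι ℤ (x 0) * ι ℤ (x 1)) (hh₁ : h₁ = ι ℤ (x 2) * ι ℤ (x 3)) (hl₁ : l₁ = ι ℤ (x 0) * ι ℤ (x 2))
    (hl₂ : l₂ = ι ℤ (x 0) * ι ℤ (x 3)) (hl₃ : l₃ = ι ℤ (x 1) * ι ℤ (x 2)) (hl₄ : l₄ = ι ℤ (x 1) * ι ℤ (x 3))
    (_hh₂ : h₂ = ι ℤ (x 4) * ι ℤ (x 5)) (_hh₃ : h₃ = ι ℤ (x 6) * ι ℤ (x 7)) (_hh₄ : h₄ = ι ℤ (x 8) * ι ℤ (x 9))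
    (_hh₅ : h₅ = ι ℤ (x 10) * ι ℤ (x 11))
    (_hH : H = h₀ + h₁) (hH₂ : H₂ = h₀ * h₁) (_hS₁ : S₁ = h₂ + h₃ + h₄ + h₅)
    (_hS₂ : S₂ = h₂ * h₃ + h₂ * h₄ + h₂ * h₅ + h₃ * h₄ + h₃ * h₅ + h₄ * h₅)
    (_hD : D = 4 * H + 8 * S₁) (hD₂ : D₂ = 16 * H₂ + 32 * (H * S₁) + 64 * S₂)
    (mB : B ∈ Submodule.span ℤ (Set.range fun p : M × M => ι ℤ p.1 * ι ℤ p.2)) (qB : B * B = 2 * B₂)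
    (hσ₁ : σ₁ = 0) (hσ₂ : σ₂ = 4 * t - σ₀) (hσ₀ : σ₀ = 2 * s + 1)
    (hT₂ : T₂ = σ₂ * D₂ - 4 * σ₁ * (D * B) + 16 * σ₀ * B₂) (hcrit : T₂ = 64 * Z₂) :
    ∃ β₀₁ β₂₃ n₁ n₂ n₃ n₄ p : ℤ, ∃ X ∈ Submodule.span ℤ (Set.range fun p : M × M => ι ℤ p.1 * ι ℤ p.2),
      B = ((β₀₁ : ExteriorAlgebra ℤ M) * h₀ + (β₂₃ : ExteriorAlgebra ℤ M) * h₁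
        + ((n₁ : ExteriorAlgebra ℤ M) * l₁ + (n₂ : ExteriorAlgebra ℤ M) * l₂ + (n₃ : ExteriorAlgebra ℤ M) * l₃
          + (n₄ : ExteriorAlgebra ℤ M) * l₄)) + 2 * X ∧
      β₀₁ * β₂₃ + (n₂ * n₃ - n₁ * n₄) = 2 * p + 1 := by
  -- `T₂ = 16(B₂ − H₂) + 32W₁`
  obtain ⟨W₁, hW₁⟩ : ∃ W₁ : ExteriorAlgebra ℤ M, W₁ = 2 * t * H₂ + 4 * t * (H * S₁) + 8 * t * S₂ - s * H₂
      - (2 * s + 1) * (H * S₁) - (4 * s + 2) * S₂ + s * B₂ := ⟨_, rfl⟩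
  have e : T₂ = 32 * W₁ + 16 * (B₂ - H₂) := by
    rw [hW₁, hT₂, hσ₁, hσ₂, hσ₀, hD₂]; noncomm_ring
  have h16 : (16 : ExteriorAlgebra ℤ M) * (B₂ - H₂) = 16 * (2 * (2 * Z₂ - W₁)) := by
    rw [eq_sub_of_add_eq' (e.symm.trans hcrit)]; noncomm_ring
  have hB₂ : B₂ = H₂ + 2 * (2 * Z₂ - W₁) := by
    have h := LeadingDigitRemainder.natCast_mul_cancel x 16 (by norm_num) _ _ (by exact_mod_cast h16)
    rw [← h]; abel
  have hBB : B * B = 2 * (ι ℤ (x 0) * ι ℤ (x 1) * (ι ℤ (x 2) * ι ℤ (x 3))) + 4 * (2 * Z₂ - W₁) := by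
    rw [qB, hB₂, hH₂, hh₀, hh₁]; noncomm_ring
  -- coefficient array and the parities of its Pfaffians
  obtain ⟨c, h0, hskew, hBc⟩ := exists_coeff_of_mem_span x B mB
  have hodd := pfaffian_odd_of_sq x c h0 hskew B _ hBc (i := 0) (j := 1) (k := 2) (l := 3)
    (by decide) (by decide) (by decide) (by decide) (by decide) (by decide) hBB
  have heven := fun i j k l hm => pfaffian_even_of_sq_outside x c h0 hskew B _ hBc 0 1 2 3 hBB i j k l hm
  -- over `𝔽₂` the array is supported on `{0, 1, 2, 3}`
  have hsupp : ∀ a b : Fin 12, a ≠ 0 → a ≠ 1 → a ≠ 2 → a ≠ 3 → (2 : ℤ) ∣ c a b := by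
    intro a b g₀ g₁ g₂ g₃
    have h := support_of_pfaffians (K := ZMod 2) (fun a b => ((c a b : ℤ) : ZMod 2))
      (fun i j => by simp only [hskew i j, Int.cast_neg]) 0 1 2 3 (by decide) (by decide) (by decide) (by decide)
      (by decide) (by decide)
      (by
        intro h
        apply hodd
        refine (ZMod.intCast_zmod_eq_zero_iff_dvd _ 2).mp ?_ |> fun h2 => by exact_mod_cast h2
        push_cast; exact h)
      (by
        intro i j k l hm
        have h2 := heven i j k l hm
        have h3 := (ZMod.intCast_zmod_eq_zero_iff_dvd _ 2).mpr (by exact_mod_cast h2)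
        push_cast at h3; exact h3)
      a b g₀ g₁ g₂ g₃
    have h3 := (ZMod.intCast_zmod_eq_zero_iff_dvd (c a b) 2).mp h
    exact_mod_cast h3
  have hsupp' : ∀ a b : Fin 12, b ≠ 0 → b ≠ 1 → b ≠ 2 → b ≠ 3 → (2 : ℤ) ∣ c a b := by
    intro a b g₀ g₁ g₂ g₃
    rw [hskew b a]
    exact (hsupp b a g₀ g₁ g₂ g₃).neg_right
  obtain ⟨X, mX, hX⟩ := split_slotPair x c hsupp hsupp'
  have hp : Odd (c 0 1 * c 2 3 - c 0 2 * c 1 3 + c 0 3 * c 1 2) := by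
    rcases Int.even_or_odd (c 0 1 * c 2 3 - c 0 2 * c 1 3 + c 0 3 * c 1 2) with h | h
    · exact absurd (even_iff_two_dvd.mp h) hodd
    · exact h
  obtain ⟨p, hp⟩ := hp
  refine ⟨c 0 1, c 2 3, c 0 2, c 0 3, c 1 2, c 1 3, p, X, mX, ?_, by linear_combination hp⟩
  rw [hh₀, hh₁, hl₁, hl₂, hl₃, hl₄, hBc, hX]

end Edge

end Summit.Ventures.HSemireg.EdgeLeadingDigit
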